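import Mathlib.CategoryTheory.SingleObj
import Mathlib.Algebra.Group.PUnit
import Literature.AlgebraicGeometry.Frobenioids.DivisorMonoidCategoryTheoreticityDefs
import Literature.AlgebraicGeometry.Frobenioids.BirationalizationProp44iiiCounterexample
import Literature.AlgebraicGeometry.Frobenioids.BirationalizationProp44UnitsProofs
import Literature.AlgebraicGeometry.Frobenioids.BirationalizationProp44General
import Literature.AlgebraicGeometry.Frobenioids.DivisorMonoidBirationalProp48
import HarnessLib

/-!
# Frobenioids I, §4: the universal closures of the INTERFACE-typed Prop. 4.4 (iii), (iv) and
# Prop. 4.8 (ii) are false (junk / genuine instances); the instance forms at THE birationalization hold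

Mochizuki, *The geometry of Frobenioids I: the general theory*, Kyushu J. Math. **62** (2008)
293–400, §4, Proposition 4.4 (iii), (iv) p. 83 and Proposition 4.8 (ii) p. 88
[cite: MochizukiFrdI2008, Prop. 4.4 (iv) p.83] [cite: MochizukiFrdI2008, Prop. 4.8 (ii) p.88].

PROOF-ONLY companion (cell abc-iut, block F fact-proving wave, seat abc-iut-f-035; FACT-LIST rows
F-1046 `Prop44iii`, F-1047 `Prop44iv`, F-1049 `Prop48ii`) of `DivisorMonoidCategoryTheoreticityDefs.lean`
(seat abc-iut-L1-t3). There the three items are typed as predicates on a birationalization DATUM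
`B : S.BiratData` — a data-only interface whose own docstring warns "a data-only interface admits junk
instances — never quantify universally over it". This file records the kernel facts that settle the
three FACT-LIST rows as SCHEMATA (rule R5: admissible at named instances only):

* `PreFrobenioidData.exists_junk_biratData` — over the "degree" operations on the one-object category
  `SingleObj ℕ⁺` (base `SingleObj PUnit`, zero divisor monoid, `deg_Fr(n) = n`; of perfect and isotropic
  type) the datum `B` with `C^birat := C`, `C → C^birat := 𝟭` and ALL Frobenius degrees reset to `1` is a
  `BiratData`; for it `C^birat` is not of perfect type and degrees are not preserved;
* `PreFrobenioidData.not_forall_prop48ii`, `PreFrobenioidData.not_forall_prop44iv` — hence the universal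
  closures (at universe level `0`) of `Prop48ii` and `Prop44iv` are FALSE;
* `PreFrobenioidData.not_forall_prop44iii` — the universal closure of `Prop44iii` is false already at a
  GENUINE instance: THE birationalization of the two-level Frobenioid (seat abc-iut-w4-d020,
  `TwoLevel.not_prop44iii_biratData_canonical`, erratum E-15: surjectivity of
  `O^×(A^birat) → Φ^birat` fails at a non-isotropic object);
* `…_schema` theorems pair each refuted closure with the PROVED instance form at THE birationalization
  `PreFrobenioid.biratData hF hsq`: Prop. 4.4 (iv) and Prop. 4.8 (ii) for EVERY Frobenioid
  (`PreFrobenioid.prop44iv_holds_of_isFrobenioid`, seat abc-iut-w5-d004; `PreFrobenioid.prop48ii_biratData`,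
  seat abc-iut-L6-t20), Prop. 4.4 (iii) for every Frobenioid of isotropic type
  (`PreFrobenioid.prop44iii_holds_of_isFrobenioid`, the generality in which §5 uses it).

Refuted-closure ≠ refuted-paper: print states the instance forms (for 4.4 (iii): true exactly in
isotropic type). No definitions; no statement of the paper is strengthened; nothing here bears on
[IUTchIII] Cor. 3.12.
-/

namespace Literature.AlgebraicGeometry.Frobenioids

open CategoryTheory

namespace PreFrobenioidData

/-! ### A junk birationalization datum over the degree operations on `SingleObj ℕ⁺` -/

/-- **A junk `BiratData`.** On `C := SingleObj ℕ⁺` over `D := SingleObj PUnit` take the operations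
`S`: zero divisor monoid, `deg_Fr(n) := n`. Every arrow is co-angular and of Frobenius type, the
pre-steps are exactly the identity, so `S` is of PERFECT and ISOTROPIC type. The datum `B`:
`C^birat := C`, `C → C^birat := 𝟭 C`, operations `ops` := the same with `deg_Fr := 1`, `Φ^birat := Φ^gp`
(trivial), divisor maps trivial — satisfies every field of the interface `BiratData`, yet `C^birat` is not
of perfect type (no arrow of degree `2`) and `C → C^birat` does not preserve the Frobenius degree `2`.
[cite: MochizukiFrdI2008, Prop. 4.4 p.82] -/
theorem exists_junk_biratData :
    ∃ (S : PreFrobenioidData.{0} (SingleObj ℕ+) (SingleObj PUnit.{1}))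
      (B : BiratData.{0, 0, 0, 0, 0, 0} S),
      S.IsOfPerfectType ∧ S.IsOfIsotropicType ∧ ¬ B.ops.IsOfPerfectType ∧
        ¬ PreservesMor B.toBirat (S.HasDegree 2) (B.ops.HasDegree 2) := by
  -- the base functor `C → D` and the two operation packages
  let bs : SingleObj ℕ+ ⥤ SingleObj PUnit.{1} := MonoidHom.toFunctor (1 : ℕ+ →* PUnit)
  let S : PreFrobenioidData.{0} (SingleObj ℕ+) (SingleObj PUnit.{1}) :=
    { base := bs
      Mon := fun _ => PUnit
      pull := fun _ => MonoidHom.id _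
      pull_id := fun _ _ => rfl
      pull_comp := fun _ _ _ => rfl
      div := fun _ => 1
      degFr := fun φ => (φ : ℕ+)
      div_id := fun _ => rfl
      div_comp := fun _ _ => rfl
      degFr_id := fun _ => rfl
      degFr_comp := fun ψ φ => mul_comm (show ℕ+ from φ) (show ℕ+ from ψ) }
  let S₁ : PreFrobenioidData.{0} (SingleObj ℕ+) (SingleObj PUnit.{1}) :=
    { base := bs
      Mon := fun _ => PUnit
      pull := fun _ => MonoidHom.id _
      pull_id := fun _ _ => rfl
      pull_comp := fun _ _ _ => rfl
      div := fun _ => 1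
      degFr := fun _ => 1
      div_id := fun _ => rfl
      div_comp := fun _ _ => rfl
      degFr_id := fun _ => rfl
      degFr_comp := fun _ _ => (mul_one _).symm }
  let B : BiratData.{0, 0, 0, 0, 0, 0} S :=
    { Birat := SingleObj ℕ+
      toBirat := 𝟭 _
      obj_surjective := fun X => ⟨X, rfl⟩
      ops := S₁
      ops_mon_eq_one := fun _ _ => rfl
      overBase := bs.leftUnitor
      phiBirat := fun _ => ⊤
      divBirat := fun _ => 1
      divBirat_mem := fun _ _ => Subgroup.mem_top _ }
  -- pre-steps of `S` are the identity `1 ∈ ℕ⁺`, hence isomorphisms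
  have hpre : ∀ {X Y : SingleObj ℕ+} (ψ : X ⟶ Y), S.IsPreStep ψ → ψ = 𝟙 _ := fun ψ h => h.1
  have hiso : ∀ {X Y : SingleObj ℕ+} (ψ : X ⟶ Y), S.IsPreStep ψ → IsIso ψ := by
    intro X Y ψ h
    have e : (show ℕ+ from ψ) = 1 := h.1
    refine ⟨⟨(show Y ⟶ X from (1 : ℕ+)), ?_, ?_⟩⟩
    · show (1 : ℕ+) * (show ℕ+ from ψ) = 1
      rw [e, mul_one]
    · show (show ℕ+ from ψ) * 1 = 1
      rw [e, mul_one]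
  have hpre' : ∀ (X : SingleObj ℕ+), S.IsPreStep (𝟙 X) := fun X =>
    ⟨rfl, (inferInstance : IsIso (bs.map (𝟙 X)))⟩
  -- every arrow of `S` is of Frobenius type
  have hfrob : ∀ {X Y : SingleObj ℕ+} (φ : X ⟶ Y), S.IsFrobeniusType φ := by
    intro X Y φ
    refine ⟨⟨?_, rfl⟩, (inferInstance : IsIso (bs.map φ))⟩
    intro X' Y' γ β α _ _ hβ _
    exact hiso β hβ.1
  refine ⟨S, B, ⟨fun A n => ⟨fun B' _ => ⟨B', (show B' ⟶ B' from n), hfrob _, rfl⟩, ?_⟩⟩,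
    ⟨fun A => fun B' φ hφ => hiso φ hφ.1⟩, ?_, ?_⟩
  · -- unique lifting of pre-steps along arrows of Frobenius type of degree `n`
    intro B₁ B₁' B₂ B₂' φ₁ φ₂ _ _ _ hn₁ _ hn₂ ψ' hψ'
    have h₁ : (show ℕ+ from φ₁) = n := hn₁
    have h₂ : (show ℕ+ from φ₂) = n := hn₂
    have hψ : (show ℕ+ from ψ') = 1 := hψ'.1
    refine ⟨𝟙 _, ⟨hpre' _, ?_⟩, fun ψ hψ => hpre ψ hψ.1⟩
    show (show ℕ+ from φ₂) * 1 = (show ℕ+ from ψ') * (show ℕ+ from φ₁)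
    rw [h₁, h₂, hψ, mul_one, one_mul]
  · -- `C^birat` is not of perfect type: no arrow of degree `2`
    intro h
    obtain ⟨B₀, φ, -, hdeg⟩ := (h.obj (SingleObj.star ℕ+) 2).1 (SingleObj.star ℕ+) ⟨Iso.refl _⟩
    have hdeg' : (1 : ℕ+) = 2 := hdeg
    exact absurd hdeg' (by decide)
  · -- the degree `2` is not preserved
    intro h
    have h2 : (1 : ℕ+) = 2 := h (show SingleObj.star ℕ+ ⟶ SingleObj.star ℕ+ from (2 : ℕ+)) rfl
    exact absurd h2 (by decide)

/-! ### The universal closures are false -/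

/-- **The universal closure of [FrdI] Prop. 4.8 (ii) AS TYPED over the interface (`Prop48ii B`,
`B : S.BiratData` arbitrary) is FALSE** (at universe level `0`): the junk datum of
`exists_junk_biratData` lives over operations of perfect and isotropic type but its `C^birat` is not of
perfect type. The printed statement is the instance at THE birationalization, PROVED for every
Frobenioid (`PreFrobenioid.prop48ii_biratData`). [cite: MochizukiFrdI2008, Prop. 4.8 (ii) p.88] -/
theorem not_forall_prop48ii :
    ¬ ∀ (C : Type) [Category.{0} C] (D : Type) [Category.{0} D] (S : PreFrobenioidData.{0} C D)
        (B : BiratData.{0, 0, 0, 0, 0, 0} S), Prop48ii S B := by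
  intro h
  obtain ⟨S, B, hperf, hiso, hnp, -⟩ := exists_junk_biratData
  exact hnp (h _ _ S B hperf hiso).1

/-- **The universal closure of [FrdI] Prop. 4.4 (iv) AS TYPED over the interface (`Prop44iv B`,
`B : S.BiratData` arbitrary) is FALSE** (at universe level `0`): for the junk datum of
`exists_junk_biratData` the clause "degrees are preserved" fails at degree `2`. The printed statement is
the instance at THE birationalization, PROVED for every Frobenioid
(`PreFrobenioid.prop44iv_holds_of_isFrobenioid`). [cite: MochizukiFrdI2008, Prop. 4.4 (iv) p.83] -/
theorem not_forall_prop44iv :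
    ¬ ∀ (C : Type) [Category.{0} C] (D : Type) [Category.{0} D] (S : PreFrobenioidData.{0} C D)
        (B : BiratData.{0, 0, 0, 0, 0, 0} S), Prop44iv B := by
  intro h
  obtain ⟨S, B, -, -, -, hdeg⟩ := exists_junk_biratData
  exact hdeg ((h _ _ S B).2.2.2.2.1 2)

/-- **The universal closure of [FrdI] Prop. 4.4 (iii) AS TYPED over the interface (`Prop44iii B`) is
FALSE** (at universe level `0`) — already at a GENUINE instance: THE birationalization of the two-level
Frobenioid (seat abc-iut-w4-d020's `TwoLevel.not_prop44iii_biratData_canonical`, erratum E-15: at the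
non-isotropic object `low` the odd germ `1 ∈ Φ^birat(∗)` is not the divisor of a unit of `low^birat`).
The instance form holds for every Frobenioid of ISOTROPIC type
(`PreFrobenioid.prop44iii_holds_of_isFrobenioid`). [cite: MochizukiFrdI2008, Prop. 4.4 (iii) p.83] -/
theorem not_forall_prop44iii :
    ¬ ∀ (C : Type) [Category.{0} C] (D : Type) [Category.{0} D] (S : PreFrobenioidData.{0} C D)
        (B : BiratData.{0, 0, 0, 0, 0, 0} S), Prop44iii B :=
  fun h => TwoLevel.not_prop44iii_biratData_canonical (h _ _ _ _)

/-! ### Schema certificates: closure refuted, instance form at THE birationalization proved -/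

/-- **F-1049 `Prop48ii` as a SCHEMA**: universal closure refuted; instance form PROVED at THE
birationalization `biratData hF hsq` of EVERY Frobenioid ("if `C` is of perfect and isotropic type, then
so is `C^birat`", seat abc-iut-L6-t20). [cite: MochizukiFrdI2008, Prop. 4.8 (ii) p.88] -/
theorem prop48ii_schema :
    (¬ ∀ (C : Type) [Category.{0} C] (D : Type) [Category.{0} D] (S : PreFrobenioidData.{0} C D)
        (B : BiratData.{0, 0, 0, 0, 0, 0} S), Prop48ii S B) ∧
      ∀ {D : Type} [Category.{0} D] {Φ : Dᵒᵖ ⥤ CommMonCat.{0}} {C : Type} [Category.{0} C]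
        {F : C ⥤ ElemFrobenioid Φ} (hF : PreFrobenioid.IsFrobenioid F)
        (hsq : PreFrobenioid.HasBiratSquares F), Prop48ii _ (PreFrobenioid.biratData hF hsq) :=
  ⟨not_forall_prop48ii, fun hF hsq => PreFrobenioid.prop48ii_biratData hF hsq⟩

/-- **F-1047 `Prop44iv` as a SCHEMA**: universal closure refuted; instance form PROVED at THE
birationalization of EVERY Frobenioid (the nine image-direction clauses, seat abc-iut-w5-d004).
[cite: MochizukiFrdI2008, Prop. 4.4 (iv) p.83] -/
theorem prop44iv_schema :
    (¬ ∀ (C : Type) [Category.{0} C] (D : Type) [Category.{0} D] (S : PreFrobenioidData.{0} C D)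
        (B : BiratData.{0, 0, 0, 0, 0, 0} S), Prop44iv B) ∧
      ∀ {D : Type} [Category.{0} D] {Φ : Dᵒᵖ ⥤ CommMonCat.{0}} {C : Type} [Category.{0} C]
        {F : C ⥤ ElemFrobenioid Φ} (hF : PreFrobenioid.IsFrobenioid F),
        Prop44iv (PreFrobenioid.biratData hF (PreFrobenioid.hasBiratSquares_of_isFrobenioid hF)) :=
  ⟨not_forall_prop44iv, fun hF => PreFrobenioid.prop44iv_holds_of_isFrobenioid hF⟩

/-- **F-1046 `Prop44iii` as a SCHEMA**: universal closure refuted (at a genuine instance, the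
two-level Frobenioid — not of isotropic type); instance form PROVED at THE birationalization of every
Frobenioid of ISOTROPIC type (seats abc-iut-L1-t10 / w4-d020). [cite: MochizukiFrdI2008, Prop. 4.4 (iii) p.83] -/
theorem prop44iii_schema :
    (¬ ∀ (C : Type) [Category.{0} C] (D : Type) [Category.{0} D] (S : PreFrobenioidData.{0} C D)
        (B : BiratData.{0, 0, 0, 0, 0, 0} S), Prop44iii B) ∧
      ∀ {D : Type} [Category.{0} D] {Φ : Dᵒᵖ ⥤ CommMonCat.{0}} {C : Type} [Category.{0} C]
        {F : C ⥤ ElemFrobenioid Φ} (hF : PreFrobenioid.IsFrobenioid F),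
        PreFrobenioid.IsOfIsotropicType F →
          Prop44iii (PreFrobenioid.biratData hF (PreFrobenioid.hasBiratSquares_of_isFrobenioid hF)) :=
  ⟨not_forall_prop44iii, fun hF hiso => PreFrobenioid.prop44iii_holds_of_isFrobenioid hF hiso⟩

end PreFrobenioidData

end Literature.AlgebraicGeometry.Frobenioids
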